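import Summits.CriticalPhenomena.PercolationContinuityZ3.Theorems.PercNearOneGluingNoHeavyLowerTailSahiSliceMinimumUniformAxisFalse
import Summits.CriticalPhenomena.PercolationContinuityZ3.Theorems.PercNearOneGluingNoHeavyLowerTailSahiSliceMinimumPair
import Mathlib.Tactic.Linarith
import Mathlib.Tactic.NormNum
import Mathlib.Tactic.FinCases
import HarnessLib

/-!
# `NoHeavyLowerTail` (crux stmt-CriticalPhenomena-4575), Sahi programme P2 (gen 16): the BERNSTEIN MINIMUM PRINCIPLE is FALSE —
# a five-coin triple whose middle control value `β₂` along one axis lies below EVERY facet value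

Support file (`--supports stmt-CriticalPhenomena-4575`; companion of `…SahiSliceMinimumBernstein`, whose typed conjecture
`SahiSliceMinimum.BernsteinMinimumPrinciple` (this seat, earlier in the same generation) it refutes).  No `sorry`, no named facts,
standard axioms; a kernel-checked finite computation.

THE CONJECTURE REFUTED.  BMP: for increasing `U₀,U₁,U₂`, every product measure and every live coin `e`, each MIDDLE Bernstein
coefficient `β₁^e, β₂^e` of the fibre cubic `s ↦ E_3(μ_{p[e↦s]})` dominates SOME facet value `E_3(μ_{p[e'↦b]})` (`e'` live,
`b ∈ {0,1}`).  It implied the slice minimum principle (`sliceMinimumPrinciple_three_of_bernstein`) and was census-clean on all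
triples of `{0,1}⁵` at two fixed measures (kit j153428) — but the statement is measure-sensitive, and a hill-climbing adversary that
optimises the measure per triple (restricted to triples without forced coordinates) refutes it at five coins.

THE WITNESS (exact).  `ι = Fin 5`,
  `A = ↑{x₀x₁, x₀x₂, x₁x₃, x₂x₃, x₁x₄, x₂x₄}`,  `B = ↑{x₁x₃, x₀x₄, x₁x₄, x₂x₄, x₃x₄}`,  `C = ↑{x₀, x₂x₃}`,
  `p = (1/5, 3/10, 1/5, 1/20, 7/20) = (4,6,4,1,7)/20`, axis `e = 0`:
`β₂⁰ = 157699/30000000 ≈ 0.0052566`, while the ten facet values are `≈ 0.00690, 0.00546 (= β₃⁰, the least), 0.00798, 0.00738, 0.00688,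
0.01107, 0.00718, 0.0532, 0.00600, 0.00639` — all larger.  (`E_3(μ_p) = 1983750157/156250000000 ≈ 0.01270` exceeds the least facet by
`0.0072`: the SLICE minimum principle holds here with room; as `p₀ → 1` the fibre along axis `0` dips `≈ 10⁻⁶` below `β₃⁰`, but by then
the facet `(3,0)` has dropped far lower — the slice principle is rescued by the OTHER axes, the Bernstein form is not.)
METHOD.  As in `…SahiSliceMinimumUniformAxisFalse`: all measures involved (`p`, `p[e'↦0]`, `p[e'↦1]`) are `n/20` with `n ∈ ℕ⁵`; section
moments `X_b = secEx p 0 · b` are expectations under `p[0↦b]` (`secEx_eq_ex_update`); every expectation is a weighted sum over the 32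
codes; `3·20¹⁵·β₂⁰` and `20¹⁵·(facets)` are integers and the ten inequalities are ONE `decide` over `(e', b) : Fin 5 × Bool`.
CONSEQUENCES.  Dead with BMP: 'MIDDLE along the axis of the least facet' and 'the fibre along the axis of the least facet attains its
minimum there' (same witness, see the file header of `…UniformAxisFalse` §census).  ALIVE: the slice minimum principle / `SliceAxis`
(`k = 5` exhaustive × 6 measures, adversarial per-triple optimisation `k ≤ 7`), which therefore cannot be proved 'one axis at a time
through the control polygon'.  HONEST FRAMING: a typed conjecture of this seat is settled in the negative; Kahn's `C_3` remains OPEN. [this work]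
-/

noncomputable section

open scoped Classical

namespace Summit.CriticalPhenomena.PercolationContinuityZ3.Theorems

namespace SahiBernsteinFalse

open Finset Function Literature.Combinatorics.Sahi2008
open Literature.Probability.Percolation.DecisionTree (ind ind_of_mem ind_of_not_mem)
open SahiC3Cube (pt)
open SahiCoordinateTwoThirdsFalse (ind_eq_ite)
open SahiUniformAxisFalse (genUp isUpperSet_genUp bGen mem_genUp_pt numW ex_of_rat sum_cast Wc)
open SahiSliceMinimum (bern₂ pat BernsteinMinimumPrinciple liveSet mem_liveSet secEx_eq_ex_update)

/-! ### 1. The witness triple and measure -/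
/-- Generators of `A` (bitmasks, bit `i` = `x_i`). [this work] -/
def gA : List ℕ := [3, 5, 10, 12, 18, 20]

/-- Generators of `B`. [this work] -/
def gB : List ℕ := [10, 17, 18, 20, 24]

/-- Generators of `C`. [this work] -/
def gC : List ℕ := [1, 12]

/-- The event `A`. [this work] -/
def bmA : Set (Set (Fin 5)) := genUp gA

/-- The event `B`. [this work] -/
def bmB : Set (Set (Fin 5)) := genUp gB

/-- The event `C`. [this work] -/
def bmC : Set (Set (Fin 5)) := genUp gC

/-- The witness triple. [this work] -/
def bmU : Fin 3 → Set (Set (Fin 5)) := ![bmA, bmB, bmC]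

/-- All three events are up-sets. [this work] -/
theorem isUpperSet_bmU : ∀ j, IsUpperSet (bmU j) := by
  intro j; fin_cases j
  · exact isUpperSet_genUp gA
  · exact isUpperSet_genUp gB
  · exact isUpperSet_genUp gC

/-- The numerators `(4,6,4,1,7)` of `p = n/20`. [this work] -/
def numer20 : Fin 5 → ℕ := ![4, 6, 4, 1, 7]

/-- Numerators are `≤ 20` (kernel check). [this work] -/
theorem numer20_le : ∀ i : Fin 5, numer20 i ≤ 20 := by decide

/-- The measure `p = (1/5, 3/10, 1/5, 1/20, 7/20)`. [this work] -/
def p20 : Fin 5 → unitInterval := fun i =>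
  ⟨(numer20 i : ℝ) / 20, by
    constructor
    · positivity
    · rw [div_le_one (by norm_num)]; exact_mod_cast numer20_le i⟩

/-- `(p_i : ℝ) = n_i / 20`. [this work] -/
theorem coe_p20 (i : Fin 5) : ((p20 i : unitInterval) : ℝ) = (numer20 i : ℝ) / 20 := rfl

/-- The coin `0` is live (`p₀ = 1/5`). [this work] -/
theorem live0 : (0 : Fin 5) ∈ liveSet p20 := by
  rw [mem_liveSet, coe_p20]
  simp only [numer20, Matrix.cons_val_zero]
  norm_num

/-! ### 2. Frozen measures `p[e ↦ 0], p[e ↦ 1]` as rational measures (any `DecidableEq` instance inside `update`) -/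

/-- Numerators of `p[e ↦ c]`: `n[e ↦ 20c]`. [this work] -/
def nUpd (e : Fin 5) (c : Bool) : Fin 5 → ℕ := Function.update numer20 e (if c then 20 else 0)

/-- Value of `n[e ↦ 20c]` at `e`. [this work] -/
theorem nUpd_self (e : Fin 5) (c : Bool) : nUpd e c e = if c then 20 else 0 := by
  unfold nUpd; rw [Function.update_self]

/-- Value of `n[e ↦ 20c]` off `e`. [this work] -/
theorem nUpd_of_ne (e : Fin 5) (c : Bool) {i : Fin 5} (h : i ≠ e) : nUpd e c i = numer20 i := by
  unfold nUpd; rw [Function.update_of_ne h]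

/-- They stay `≤ 20`. [this work] -/
theorem nUpd_le (e : Fin 5) (c : Bool) : ∀ i, nUpd e c i ≤ 20 := by
  intro i
  by_cases h : i = e
  · subst h; rw [nUpd_self]; cases c <;> simp
  · rw [nUpd_of_ne e c h]; exact numer20_le i

/-- `update` evaluated, for an ARBITRARY `DecidableEq` instance (the tree's lemmas carry the classical one). [folklore] -/
theorem upd_apply_any (inst : DecidableEq (Fin 5)) (f : Fin 5 → unitInterval) (a : Fin 5) (v : unitInterval) (i : Fin 5) :
    @Function.update (Fin 5) (fun _ => unitInterval) inst f a v i = if i = a then v else f i := by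
  convert Function.update_apply f a v i

/-- Coordinates of `p[e ↦ 1]`. [this work] -/
theorem coe_upd_one (inst : DecidableEq (Fin 5)) (e : Fin 5) :
    ∀ i, ((@Function.update (Fin 5) (fun _ => unitInterval) inst p20 e 1 i : unitInterval) : ℝ) = (nUpd e true i : ℝ) / 20 := by
  intro i
  rw [upd_apply_any inst p20 e 1 i]
  by_cases h : i = e
  · subst h; rw [if_pos rfl, nUpd_self]; simp
  · rw [if_neg h, nUpd_of_ne e true h, coe_p20]

/-- Coordinates of `p[e ↦ 0]`. [this work] -/
theorem coe_upd_zero (inst : DecidableEq (Fin 5)) (e : Fin 5) :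
    ∀ i, ((@Function.update (Fin 5) (fun _ => unitInterval) inst p20 e 0 i : unitInterval) : ℝ) = (nUpd e false i : ℝ) / 20 := by
  intro i
  rw [upd_apply_any inst p20 e 0 i]
  by_cases h : i = e
  · subst h; rw [if_pos rfl, nUpd_self]; simp
  · rw [if_neg h, nUpd_of_ne e false h, coe_p20]

/-- Expectation under `p[e ↦ 1]` as a weighted code sum. [this work] -/
theorem ex_upd_one (inst : DecidableEq (Fin 5)) (e : Fin 5) (F : Set (Fin 5) → ℝ) :
    ex (bernoulliWeight (@Function.update (Fin 5) (fun _ => unitInterval) inst p20 e 1)) F =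
      (1 / (20 : ℝ) ^ 5) * ∑ j ∈ Finset.range 32, (numW (nUpd e true) 20 j : ℝ) * F (pt 5 j) := by
  have h := ex_of_rat (@Function.update (Fin 5) (fun _ => unitInterval) inst p20 e 1) (nUpd e true) 20 (by norm_num)
    (coe_upd_one inst e) (nUpd_le e true) F
  rw [h]; norm_num

/-- Expectation under `p[e ↦ 0]` as a weighted code sum. [this work] -/
theorem ex_upd_zero (inst : DecidableEq (Fin 5)) (e : Fin 5) (F : Set (Fin 5) → ℝ) :
    ex (bernoulliWeight (@Function.update (Fin 5) (fun _ => unitInterval) inst p20 e 0)) F =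
      (1 / (20 : ℝ) ^ 5) * ∑ j ∈ Finset.range 32, (numW (nUpd e false) 20 j : ℝ) * F (pt 5 j) := by
  have h := ex_of_rat (@Function.update (Fin 5) (fun _ => unitInterval) inst p20 e 0) (nUpd e false) 20 (by norm_num)
    (coe_upd_zero inst e) (nUpd_le e false) F
  rw [h]; norm_num

/-! ### 3. Boolean membership, weighted counts, and the integer forms of the facets and of `β₂⁰` -/

/-- Bits of `A`, `B`, `C`. [this work] -/
def cA (j : ℕ) : Bool := bGen gA j

/-- Bits of `B`. [this work] -/
def cB (j : ℕ) : Bool := bGen gB j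

/-- Bits of `C`. [this work] -/
def cC (j : ℕ) : Bool := bGen gC j

/-- Memberships of coded points. [this work] -/
theorem mem_bm (j : ℕ) : (pt 5 j ∈ bmA ↔ cA j = true) ∧ (pt 5 j ∈ bmB ↔ cB j = true) ∧ (pt 5 j ∈ bmC ↔ cC j = true) :=
  ⟨mem_genUp_pt gA j, mem_genUp_pt gB j, mem_genUp_pt gC j⟩

/-- `W(e,c,X) = Σ_{j ∈ X} numW(n[e ↦ 20c], 20, j)` — `20⁵ ×` the mass of `X` under `p[e ↦ c]`. [this work] -/
def W (e : Fin 5) (c : Bool) (X : ℕ → Bool) : ℕ := Wc (nUpd e c) 20 X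

/-- `20¹⁵ ×` the positive part of the facet value `E_3(μ_{p[e↦c]})`. [this work] -/
def FacP (e : Fin 5) (c : Bool) : ℕ :=
  2 * 20 ^ 10 * W e c (fun j => cA j && cB j && cC j) + W e c cA * W e c cB * W e c cC

/-- `20¹⁵ ×` the negative part of the facet value. [this work] -/
def FacM (e : Fin 5) (c : Bool) : ℕ :=
  20 ^ 5 * (W e c cA * W e c (fun j => cB j && cC j) + W e c cB * W e c (fun j => cA j && cC j) +
    W e c cC * W e c (fun j => cA j && cB j))

/-- `20¹⁵ ×` the positive part of the polarisation pattern `(c₀, c₁, c₂)` along axis `0`. [this work] -/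
def PatP (c₀ c₁ c₂ : Bool) : ℕ :=
  2 * 20 ^ 10 * W 0 c₀ (fun j => cA j && cB j && cC j) + W 0 c₀ cA * W 0 c₁ cB * W 0 c₂ cC

/-- `20¹⁵ ×` the negative part of the pattern `(c₀, c₁, ·)`. [this work] -/
def PatM (c₀ c₁ : Bool) : ℕ :=
  20 ^ 5 * (W 0 c₁ cA * W 0 c₀ (fun j => cB j && cC j) + W 0 c₁ cB * W 0 c₀ (fun j => cA j && cC j) +
    W 0 c₁ cC * W 0 c₀ (fun j => cA j && cB j))

/-- `3·20¹⁵·β₂⁰ = B2P − B2M`: positive part. [this work] -/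
def B2P : ℕ := PatP true true false + PatP true false true + PatP false true true

/-- Negative part. [this work] -/
def B2M : ℕ := PatM true true + PatM true false + PatM false true

/-- **THE TEN KERNEL INEQUALITIES** (one `decide`): every facet exceeds `β₂⁰`, i.e. `B2P + 3·FacM(e,c) < 3·FacP(e,c) + B2M`. [this work] -/
theorem kernel_ineqs : ∀ e : Fin 5, ∀ c : Bool, B2P + 3 * FacM e c < 3 * FacP e c + B2M := by
  decide

/-! ### 4. The real-side evaluations -/

/-- The facet value `E_3(μ_{p[e↦1]}) = (FacP − FacM)(e, 1)/20¹⁵` (any instance inside `update`). [this work] -/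
theorem facet_one (inst : DecidableEq (Fin 5)) (e : Fin 5) :
    sahiE (bernoulliWeight (@Function.update (Fin 5) (fun _ => unitInterval) inst p20 e 1)) 3 ![ind bmA, ind bmB, ind bmC] =
      ((FacP e true : ℝ) - (FacM e true : ℝ)) / (20 : ℝ) ^ 15 := by
  rw [sahiE_three]
  simp only [ex_upd_one inst e, Pi.mul_apply, ind_eq_ite _ _ _ (mem_bm _).1, ind_eq_ite _ _ _ (mem_bm _).2.1,
    ind_eq_ite _ _ _ (mem_bm _).2.2, SahiCoordinateTwoThirdsFalse.ite_mul_ite, sum_cast]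
  rw [FacP, FacM, W, W, W, W, W, W, W]
  generalize Wc (nUpd e true) 20 (fun j => cA j && cB j && cC j) = S7
  generalize Wc (nUpd e true) 20 (fun j => cA j && cB j) = S4
  generalize Wc (nUpd e true) 20 (fun j => cA j && cC j) = S5
  generalize Wc (nUpd e true) 20 (fun j => cB j && cC j) = S6
  generalize Wc (nUpd e true) 20 cA = S1
  generalize Wc (nUpd e true) 20 cB = S2
  generalize Wc (nUpd e true) 20 cC = S3
  push_cast
  field_simp
  ring

/-- The facet value `E_3(μ_{p[e↦0]}) = (FacP − FacM)(e, 0)/20¹⁵`. [this work] -/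
theorem facet_zero (inst : DecidableEq (Fin 5)) (e : Fin 5) :
    sahiE (bernoulliWeight (@Function.update (Fin 5) (fun _ => unitInterval) inst p20 e 0)) 3 ![ind bmA, ind bmB, ind bmC] =
      ((FacP e false : ℝ) - (FacM e false : ℝ)) / (20 : ℝ) ^ 15 := by
  rw [sahiE_three]
  simp only [ex_upd_zero inst e, Pi.mul_apply, ind_eq_ite _ _ _ (mem_bm _).1, ind_eq_ite _ _ _ (mem_bm _).2.1,
    ind_eq_ite _ _ _ (mem_bm _).2.2, SahiCoordinateTwoThirdsFalse.ite_mul_ite, sum_cast]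
  rw [FacP, FacM, W, W, W, W, W, W, W]
  generalize Wc (nUpd e false) 20 (fun j => cA j && cB j && cC j) = S7
  generalize Wc (nUpd e false) 20 (fun j => cA j && cB j) = S4
  generalize Wc (nUpd e false) 20 (fun j => cA j && cC j) = S5
  generalize Wc (nUpd e false) 20 (fun j => cB j && cC j) = S6
  generalize Wc (nUpd e false) 20 cA = S1
  generalize Wc (nUpd e false) 20 cB = S2
  generalize Wc (nUpd e false) 20 cC = S3
  push_cast
  field_simp
  ring

/-- **`β₂` along axis `0` at `p`**: `β₂⁰ = (B2P − B2M)/(3·20¹⁵)` (section moments are expectations under `p[0↦1]`, `p[0↦0]`).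
[this work] -/
theorem bern2_eq : bern₂ p20 0 (ind bmA) (ind bmB) (ind bmC) = (((B2P : ℝ) - (B2M : ℝ)) / 3) / (20 : ℝ) ^ 15 := by
  simp only [bern₂, pat, secEx_eq_ex_update, if_true, Bool.false_eq_true, if_false, ex_upd_one _ 0, ex_upd_zero _ 0,
    Pi.mul_apply, ind_eq_ite _ _ _ (mem_bm _).1, ind_eq_ite _ _ _ (mem_bm _).2.1, ind_eq_ite _ _ _ (mem_bm _).2.2,
    SahiCoordinateTwoThirdsFalse.ite_mul_ite, sum_cast]
  rw [B2P, B2M, PatP, PatP, PatP, PatM, PatM, PatM]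
  simp only [W]
  generalize Wc (nUpd 0 true) 20 (fun j => cA j && cB j && cC j) = T7
  generalize Wc (nUpd 0 true) 20 (fun j => cA j && cB j) = T4
  generalize Wc (nUpd 0 true) 20 (fun j => cA j && cC j) = T5
  generalize Wc (nUpd 0 true) 20 (fun j => cB j && cC j) = T6
  generalize Wc (nUpd 0 true) 20 cA = T1
  generalize Wc (nUpd 0 true) 20 cB = T2
  generalize Wc (nUpd 0 true) 20 cC = T3
  generalize Wc (nUpd 0 false) 20 (fun j => cA j && cB j && cC j) = S7
  generalize Wc (nUpd 0 false) 20 (fun j => cA j && cB j) = S4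
  generalize Wc (nUpd 0 false) 20 (fun j => cA j && cC j) = S5
  generalize Wc (nUpd 0 false) 20 (fun j => cB j && cC j) = S6
  generalize Wc (nUpd 0 false) 20 cA = S1
  generalize Wc (nUpd 0 false) 20 cB = S2
  generalize Wc (nUpd 0 false) 20 cC = S3
  push_cast
  field_simp
  ring

/-! ### 5. The refutation -/

/-- **No facet value is `≤ β₂⁰`** (for any `DecidableEq` instance inside `update`, in particular the one in the statement of BMP).
[this work] -/
theorem facet_not_le (inst : DecidableEq (Fin 5)) (e : Fin 5) (b : unitInterval) (hb : (b : ℝ) = 0 ∨ (b : ℝ) = 1) :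
    ¬ sahiE (bernoulliWeight (@Function.update (Fin 5) (fun _ => unitInterval) inst p20 e b)) 3 ![ind bmA, ind bmB, ind bmC] ≤
        bern₂ p20 0 (ind bmA) (ind bmB) (ind bmC) := by
  have hpos : (0 : ℝ) < (20 : ℝ) ^ 15 := by positivity
  have hb' : b = 0 ∨ b = 1 := by
    rcases hb with h0 | h1
    · exact Or.inl (Subtype.ext (h0.trans Set.Icc.coe_zero.symm))
    · exact Or.inr (Subtype.ext (h1.trans Set.Icc.coe_one.symm))
  rw [not_le, bern2_eq]
  rcases hb' with rfl | rfl
  · have hk : (B2P : ℝ) + 3 * (FacM e false : ℝ) < 3 * (FacP e false : ℝ) + (B2M : ℝ) := by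
      exact_mod_cast kernel_ineqs e false
    rw [facet_zero inst e, div_lt_div_iff_of_pos_right hpos]
    linarith
  · have hk : (B2P : ℝ) + 3 * (FacM e true : ℝ) < 3 * (FacP e true : ℝ) + (B2M : ℝ) := by
      exact_mod_cast kernel_ineqs e true
    rw [facet_one inst e, div_lt_div_iff_of_pos_right hpos]
    linarith

/-- **THE BERNSTEIN MINIMUM PRINCIPLE (`SahiSliceMinimum.BernsteinMinimumPrinciple`) IS FALSE.**  Witness: the triple
`(A, B, C)` on `Fin 5`, `p = (1/5, 3/10, 1/5, 1/20, 7/20)`, live coin `0`: no facet value is `≤ β₂⁰`. [this work] -/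
theorem not_bernsteinMinimumPrinciple : ¬ BernsteinMinimumPrinciple := by
  intro h
  have hU : (fun j => ind (bmU j)) = ![ind bmA, ind bmB, ind bmC] := by
    funext j; fin_cases j <;> rfl
  obtain ⟨-, e', -, b, hb, hle⟩ := h (Fin 5) p20 bmU isUpperSet_bmU 0 live0
  rw [hU] at hle
  exact facet_not_le _ e' b hb hle

end SahiBernsteinFalse

end Summit.CriticalPhenomena.PercolationContinuityZ3.Theorems
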